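import Summits.AtomisticToContinuum.FouriersLaw.Theorems.BondHeatUncertaintySubdiffusiveBondHeatKernelGibbsE
import Literature.MathematicalPhysics.KineticTheory.SdeGeneratorCalculus

/-!
# `SubdiffusiveBondHeat` / Dynkin's identity for the bath-site energy, part 1: truncation machinery

Support file for stub `stub_siteEnergyDynkin` (label (H3)) of line `bath-bond-deficit-integral` of crux
`stmt-AtomisticToContinuum-9120` (`BondHeatUncertainty.SubdiffusiveBondHeat`): Dynkin's identity
`P_r e₀(z) - e₀(z) = ∫₀ʳ P_s(L e₀)(z) ds` for the CONSTRUCTED transition kernels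
`P_t = OscillatorChain.transitionKernel N T T t` of the pinned anharmonic chain and the polynomially growing bath-site
energy `e₀`. The tree has Dynkin's identity for `C²_c` observables only (`IsConfining.langevinKernel_dynkin`,
`pinnedChain_dynkin`); the extension to polynomially bounded observables is a TRUNCATION argument, whose two
model-independent ingredients are proved here:

* `pinnedChain_dynkin_of_truncation` (closed form `pinnedChain_dynkinByTruncation`) — if `f_n ∈ C²_c`, `f_n → e`,
  `L f_n → ℓ` pointwise with `|f_n|, |L f_n| ≤ K e^{θH}` (`0 < θ < 1/T`), then Dynkin's identity holds for `(e, ℓ)`: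
  Dynkin for `f_n`, dominated convergence in `y` (the kernels integrate `e^{θH}`: CEHR (3.4),
  `pinnedChain_integral_exp_mul_hamiltonian_transitionKernel_le`) and in `s ∈ [0, r]`, uniqueness of limits;
* `generator_mul_smoothCutoff_hamiltonian` — the generator of a truncated observable `e χ(H/R)` (`χ = smoothCutoff`)
  for any chain with `C²` potentials: `L(e χ_R) = χ_R Le + e Lχ_R + Γ(e, χ_R)` with `Lχ_R` and the carré du champ
  `Γ(e, χ_R)` explicit (product rule `sdeGenerator_mul`, chain rule `sdeGenerator_comp`, `LH`, `DH·v_b`,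
  `De·v_b = √(2γT_b) ∂_{p_b} e`).

Part 2 (`…SiteEnergyDynkin.lean`) applies this to `e = e₀`. Nothing here closes an item.
-/

noncomputable section

open MeasureTheory ProbabilityTheory Filter Topology Set
open scoped NNReal ENNReal

namespace Summit.AtomisticToContinuum.FouriersLaw.Theorems.SubdiffusiveBondHeat

open Literature.MathematicalPhysics.KineticTheory.HeatConduction
open Literature.MathematicalPhysics.KineticTheory Literature.Probability.Process OscillatorChain

variable {N : ℕ}

/-! ### Dynkin's identity by truncation -/

section Truncation

variable {ω₂ lam β γ : ℝ} (hω : 0 < ω₂) (hl : 0 ≤ lam) (hβ : 0 < β) (hγ : 0 < γ) {N : ℕ}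
include hω hl hβ hγ

/-- `s ↦ ∫ g dP_{s⁺}(z, ·)` is measurable on `ℝ` for measurable `g` (joint measurability of the transition kernels
in `(t, z)`). [folklore] -/
theorem pinnedChain_measurable_integral_transitionKernel_time (T_L T_R : ℝ) {g : PhaseSpace N → ℝ}
    (hg : Measurable g) (z : PhaseSpace N) :
    Measurable fun s : ℝ => ∫ y, g y ∂((pinnedChain ω₂ lam β γ).transitionKernel N T_L T_R s.toNNReal z) := by
  let κ₂ : Kernel (ℝ≥0 × PhaseSpace N) (PhaseSpace N) :=
    { toFun := fun p => (pinnedChain ω₂ lam β γ).transitionKernel N T_L T_R p.1 p.2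
      measurable' := pinnedChain_measurable_transitionKernel hω hl hβ.le hγ.le N T_L T_R }
  have hG : StronglyMeasurable fun p : ℝ≥0 × PhaseSpace N => ∫ y, g y ∂(κ₂ p) :=
    hg.stronglyMeasurable.integral_kernel (κ := κ₂)
  have h1 : Measurable fun s : ℝ => (s.toNNReal, z) := measurable_real_toNNReal.prodMk measurable_const
  have h2 := hG.measurable.comp h1
  exact h2

variable (hN : 0 < N) {T : ℝ} (hT : 0 < T)
include hN hT

/-- CEHR (3.4) for the Bochner integral: `∫ e^{θH} dP_t(z, ·) ≤ e^{θγ(T+T)t} e^{θH(z)}` for `0 < θ < 1/T`.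
[cite: CuneoEckmannHairerReyBellet2018, §3 eq. (3.4)] -/
theorem pinnedChain_integral_exp_mul_hamiltonian_transitionKernel_le {θ : ℝ} (hθ : 0 < θ) (hθ' : θ < 1 / T)
    (t : ℝ≥0) (z : PhaseSpace N) :
    ∫ y, Real.exp (θ * (pinnedChain ω₂ lam β γ).hamiltonian N y)
        ∂((pinnedChain ω₂ lam β γ).transitionKernel N T T t z) ≤
      Real.exp (θ * γ * (T + T) * t) * Real.exp (θ * (pinnedChain ω₂ lam β γ).hamiltonian N z) := by
  have hmax : θ < 1 / max T T := by rwa [max_self]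
  have h34 := lintegral_exp_mul_hamiltonian_pinnedChainSemigroup_le hω hl hβ.le hγ.le hN hT.le hT.le hT hT hθ
    hmax t z
  have hint := pinnedChain_integrable_exp_mul_hamiltonian_transitionKernel hω hl hT hβ.le hγ.le hN hθ hθ' t z
  rw [← ENNReal.ofReal_le_ofReal_iff (by positivity),
    ofReal_integral_eq_lintegral_ofReal hint (Eventually.of_forall fun y => (Real.exp_pos _).le)]
  exact h34

/-- **Dynkin's identity by truncation.** Let `e, ℓ` be continuous observables of the pinned chain (`ω₂, β, γ > 0`,
`lam ≥ 0`, `N ≥ 1`, equal bath temperatures `T > 0`) and `f_n ∈ C²_c` truncations with `f_n → e`, `L f_n → ℓ`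
pointwise and `|f_n|, |L f_n| ≤ K e^{θH}` uniformly in `n` for some `0 < θ < 1/T`. Then Dynkin's identity
`P_r e(z) - e(z) = ∫₀ʳ P_s ℓ(z) ds` holds for the transition kernels: Dynkin for `f_n`
(`IsConfining.langevinKernel_dynkin`), dominated convergence in `y` (the kernels integrate `e^{θH}`, CEHR (3.4)) and
in `s ∈ [0, r]` (the bound `K e^{2θγTr} e^{θH(z)}` is uniform), uniqueness of limits.
[cite: CuneoEckmannHairerReyBellet2018, §3 eq. (3.4)] -/
theorem pinnedChain_dynkin_of_truncation {θ K : ℝ} (hθ : 0 < θ) (hθ' : θ < 1 / T)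
    {e ℓ : PhaseSpace N → ℝ} (f : ℕ → PhaseSpace N → ℝ) (hf : ∀ n, ContDiff ℝ 2 (f n)) (hfs : ∀ n, HasCompactSupport (f n))
    (hfe : ∀ y, Tendsto (fun n => f n y) atTop (𝓝 (e y)))
    (hfℓ : ∀ y, Tendsto (fun n => (pinnedChain ω₂ lam β γ).generator N T T (f n) y) atTop (𝓝 (ℓ y)))
    (hfb : ∀ n y, |f n y| ≤ K * Real.exp (θ * (pinnedChain ω₂ lam β γ).hamiltonian N y))
    (hLb : ∀ n y, |(pinnedChain ω₂ lam β γ).generator N T T (f n) y| ≤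
      K * Real.exp (θ * (pinnedChain ω₂ lam β γ).hamiltonian N y))
    (r : ℝ≥0) (z : PhaseSpace N) :
    ∫ y, e y ∂((pinnedChain ω₂ lam β γ).transitionKernel N T T r z) - e z =
      ∫ s in (0 : ℝ)..(r : ℝ), ∫ y, ℓ y ∂((pinnedChain ω₂ lam β γ).transitionKernel N T T s.toNNReal z) := by
  set P := pinnedChain ω₂ lam β γ with hP
  set κ := P.transitionKernel N T T with hκ
  set H := P.hamiltonian N with hH
  haveI : ∀ s, IsMarkovKernel (κ s) := fun s =>
    pinnedChain_isMarkovKernel_transitionKernel hω hl hβ.le hγ.le N T T s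
  have hconf : P.IsConfining := pinnedChain_isConfining hω hl hβ.le hγ.le
  set W : PhaseSpace N → ℝ := fun y => Real.exp (θ * H y) with hW
  have hWint : ∀ s : ℝ≥0, Integrable W (κ s z) := fun s =>
    pinnedChain_integrable_exp_mul_hamiltonian_transitionKernel hω hl hT hβ.le hγ.le hN hθ hθ' s z
  have hWle : ∀ s : ℝ≥0, ∫ y, W y ∂(κ s z) ≤ Real.exp (θ * γ * (T + T) * s) * W z := fun s =>
    pinnedChain_integral_exp_mul_hamiltonian_transitionKernel_le hω hl hβ hγ hN hT hθ hθ' s z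
  have hK0 : 0 ≤ K := by
    by_contra h
    push Not at h
    have h1 := hfb 0 z
    nlinarith [abs_nonneg (f 0 z), Real.exp_pos (θ * H z)]
  have hker : ∀ t, P.langevinKernel N T T t = κ t := fun t =>
    pinnedChain_langevinKernel_eq_transitionKernel N T T hω hl hβ.le hγ.le t
  -- the generators of the truncations
  set L : ℕ → PhaseSpace N → ℝ := fun n => P.generator N T T (f n) with hL
  have hLc : ∀ n, Continuous (L n) := fun n =>
    P.continuous_generator (pinnedChain_contDiff_U ω₂ lam β γ) (pinnedChain_contDiff_V ω₂ lam β γ) N T T (hf n)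
  have hfc : ∀ n, Continuous (f n) := fun n => (hf n).continuous
  -- Dynkin for the truncations
  have hdyn : ∀ n, ∫ y, f n y ∂(κ r z) - f n z = ∫ s in (0:ℝ)..(r:ℝ), ∫ y, L n y ∂(κ s.toNNReal z) := by
    intro n
    have h := hconf.langevinKernel_dynkin N T T hN hT.le hT.le (hf n) (hfs n) r z
    simp only [hker] at h
    exact h
  -- the left-hand side converges
  have hLHS : Tendsto (fun n => ∫ y, f n y ∂(κ r z) - f n z) atTop (𝓝 (∫ y, e y ∂(κ r z) - e z)) := by
    refine Tendsto.sub ?_ (hfe z)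
    exact tendsto_integral_of_dominated_convergence (fun y => K * W y)
      (fun n => (hfc n).aestronglyMeasurable) ((hWint r).const_mul K)
      (fun n => Eventually.of_forall fun y => by rw [Real.norm_eq_abs]; exact hfb n y)
      (Eventually.of_forall hfe)
  -- the right-hand side converges
  have hB : ∀ (n : ℕ) (s : ℝ), s ∈ uIoc (0:ℝ) r →
      ‖∫ y, L n y ∂(κ s.toNNReal z)‖ ≤ K * (Real.exp (θ * γ * (T + T) * r) * W z) := by
    intro n s hs
    rw [uIoc_of_le r.coe_nonneg] at hs
    have hs0 : 0 ≤ s := hs.1.le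
    have hsr : s ≤ r := hs.2
    rw [Real.norm_eq_abs]
    calc |∫ y, L n y ∂(κ s.toNNReal z)| ≤ ∫ y, |L n y| ∂(κ s.toNNReal z) := abs_integral_le_integral_abs
      _ ≤ ∫ y, K * W y ∂(κ s.toNNReal z) :=
          integral_mono_of_nonneg (Eventually.of_forall fun y => abs_nonneg _) ((hWint _).const_mul K)
            (Eventually.of_forall fun y => hLb n y)
      _ = K * ∫ y, W y ∂(κ s.toNNReal z) := integral_const_mul _ _
      _ ≤ K * (Real.exp (θ * γ * (T + T) * (s.toNNReal : ℝ≥0)) * W z) :=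
          mul_le_mul_of_nonneg_left (hWle _) hK0
      _ ≤ K * (Real.exp (θ * γ * (T + T) * r) * W z) := by
          apply mul_le_mul_of_nonneg_left _ hK0
          apply mul_le_mul_of_nonneg_right _ (Real.exp_pos _).le
          apply Real.exp_le_exp.2
          rw [Real.coe_toNNReal _ hs0]
          have : 0 ≤ θ * γ * (T + T) := by positivity
          exact mul_le_mul_of_nonneg_left hsr this
  have hRHS : Tendsto (fun n => ∫ s in (0:ℝ)..(r:ℝ), ∫ y, L n y ∂(κ s.toNNReal z)) atTop
      (𝓝 (∫ s in (0:ℝ)..(r:ℝ), ∫ y, ℓ y ∂(κ s.toNNReal z))) := by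
    refine intervalIntegral.tendsto_integral_filter_of_dominated_convergence
      (fun _ => K * (Real.exp (θ * γ * (T + T) * r) * W z)) ?_ ?_ ?_ ?_
    · exact Eventually.of_forall fun n =>
        (pinnedChain_measurable_integral_transitionKernel_time hω hl hβ hγ T T (hLc n).measurable
          z).aestronglyMeasurable
    · exact Eventually.of_forall fun n => Eventually.of_forall fun s hs => hB n s hs
    · exact intervalIntegrable_const
    · refine Eventually.of_forall fun s _ => ?_
      exact tendsto_integral_of_dominated_convergence (fun y => K * W y)
        (fun n => (hLc n).aestronglyMeasurable) ((hWint _).const_mul K)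
        (fun n => Eventually.of_forall fun y => by rw [Real.norm_eq_abs]; exact hLb n y)
        (Eventually.of_forall hfℓ)
  have hEq : (fun n => ∫ y, f n y ∂(κ r z) - f n z) =
      fun n => ∫ s in (0:ℝ)..(r:ℝ), ∫ y, L n y ∂(κ s.toNNReal z) := funext hdyn
  rw [hEq] at hLHS
  exact tendsto_nhds_unique hLHS hRHS

end Truncation

/-! ### The generator of a truncated observable `e · χ(H/R)` -/

section GeneratorCutoff

variable (P : OscillatorChain) {N : ℕ}

omit P in
/-- `Df(y)·(bathVec N k c) = c ∂_{p_k} f(y)` for differentiable `f` (`k < N`). [folklore] -/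
theorem fderiv_apply_bathVec {f : PhaseSpace N → ℝ} (hf : Differentiable ℝ f) (y : PhaseSpace N) {k : ℕ}
    (hk : k < N) (c : ℝ) : fderiv ℝ f y (bathVec N k c) = c * partialP ⟨k, hk⟩ f y := by
  rw [bathVec_eq_smul_unitP hk c, map_smul, smul_eq_mul, partialP_eq_fderiv hf, unitP_eq]

omit P in
/-- `v ↦ χ'(v/R)/R` has derivative `χ''(v/R)/R²`. [folklore] -/
theorem hasDerivAt_deriv_scaled_smoothCutoff (R v : ℝ) :
    HasDerivAt (fun v => deriv smoothCutoff (v / R) / R) (deriv (deriv smoothCutoff) (v / R) / R ^ 2) v := by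
  have h := ((hasDerivAt_deriv_smoothCutoff (v / R)).comp v ((hasDerivAt_id v).div_const R)).div_const R
  refine h.congr_deriv ?_
  ring

omit P in
/-- `∑_i ([i=0](T_L - p_i²) + [i=N-1](T_R - p_i²)) = (T_L - p₀²) + (T_R - p²_{N-1})` (`N ≥ 1`). [folklore] -/
theorem sum_bath_ite_eq (hN : 0 < N) (T_L T_R : ℝ) (x : PhaseSpace N) :
    ∑ i : Fin N, ((if i.val = 0 then T_L - x.2 i ^ 2 else 0) + (if i.val = N - 1 then T_R - x.2 i ^ 2 else 0)) =
      (T_L - x.2 ⟨0, hN⟩ ^ 2) + (T_R - x.2 ⟨N - 1, Nat.sub_lt hN one_pos⟩ ^ 2) := by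
  rw [Finset.sum_add_distrib]
  have e1 : ∑ i : Fin N, (if i.val = 0 then T_L - x.2 i ^ 2 else 0) =
      ∑ i : Fin N, (if i.val = 0 then (1:ℝ) else 0) * (T_L - x.2 i ^ 2) :=
    Finset.sum_congr rfl fun i _ => by split_ifs <;> simp
  have e2 : ∑ i : Fin N, (if i.val = N - 1 then T_R - x.2 i ^ 2 else 0) =
      ∑ i : Fin N, (if i.val = N - 1 then (1:ℝ) else 0) * (T_R - x.2 i ^ 2) :=
    Finset.sum_congr rfl fun i _ => by split_ifs <;> simp
  rw [e1, e2, sum_ite_val_eq_mul hN 1 (fun i => T_L - x.2 i ^ 2),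
    sum_ite_val_eq_mul (Nat.sub_lt hN one_pos) 1 (fun i => T_R - x.2 i ^ 2)]
  ring

variable {P}

/-- **The generator of a truncated observable.** For `C²` potentials, `N ≥ 1`, `γT_L, γT_R ≥ 0`, `e ∈ C²` and the
cutoff `χ_R = χ(H/R)` of the energy (`χ = smoothCutoff`):
`L(e χ_R) = χ_R Le + e Lχ_R + Γ(e, χ_R)` (product rule `sdeGenerator_mul`) with
`Lχ_R = γ[χ'(H/R)/R (T_L + T_R - p₀² - p²_{N-1}) + χ''(H/R)/R² (T_L p₀² + T_R p²_{N-1})]` (chain rule, `LH`,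
`(DH·v_b)² = 2γT_b p_b²`) and `Γ(e, χ_R) = χ'(H/R)/R (2γT_L p₀ ∂_{p₀}e + 2γT_R p_{N-1} ∂_{p_{N-1}}e)`.
[cite: HairerMattingly2009, §5 (Itô's formula for products)] -/
theorem generator_mul_smoothCutoff_hamiltonian (hU : ContDiff ℝ 2 P.U) (hV : ContDiff ℝ 2 P.V) (hN : 0 < N)
    {T_L T_R : ℝ} (hL : 0 ≤ P.γ * T_L) (hR : 0 ≤ P.γ * T_R) {e : PhaseSpace N → ℝ} (he : ContDiff ℝ 2 e)
    (R : ℝ) (x : PhaseSpace N) :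
    P.generator N T_L T_R (fun y => e y * smoothCutoff (P.hamiltonian N y / R)) x =
      smoothCutoff (P.hamiltonian N x / R) * P.generator N T_L T_R e x +
      (e x * (P.γ * (deriv smoothCutoff (P.hamiltonian N x / R) / R *
            (T_L + T_R - x.2 ⟨0, hN⟩ ^ 2 - x.2 ⟨N - 1, Nat.sub_lt hN one_pos⟩ ^ 2) +
          deriv (deriv smoothCutoff) (P.hamiltonian N x / R) / R ^ 2 *
            (T_L * x.2 ⟨0, hN⟩ ^ 2 + T_R * x.2 ⟨N - 1, Nat.sub_lt hN one_pos⟩ ^ 2))) +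
        deriv smoothCutoff (P.hamiltonian N x / R) / R *
          (2 * P.γ * T_L * x.2 ⟨0, hN⟩ * partialP ⟨0, hN⟩ e x +
            2 * P.γ * T_R * x.2 ⟨N - 1, Nat.sub_lt hN one_pos⟩ *
              partialP ⟨N - 1, Nat.sub_lt hN one_pos⟩ e x)) := by
  have hN1 : N - 1 < N := Nat.sub_lt hN one_pos
  have hH2 : ContDiff ℝ 2 (P.hamiltonian N) := P.contDiff_hamiltonian hU hV N
  have hHd : Differentiable ℝ (P.hamiltonian N) := hH2.differentiable (by norm_num)
  have hed : Differentiable ℝ e := he.differentiable (by norm_num)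
  have hχ2 : ContDiff ℝ 2 fun y => smoothCutoff (P.hamiltonian N y / R) :=
    (contDiff_smoothCutoff (n := 2)).comp (hH2.div_const R)
  have hprod : ContDiff ℝ 2 fun y => e y * smoothCutoff (P.hamiltonian N y / R) := he.mul hχ2
  rw [← P.sdeGenerator_drift_eq_generator hN hL hR hprod, ← P.sdeGenerator_drift_eq_generator hN hL hR he,
    sdeGenerator_mul' _ _ _ he hχ2 x]
  -- the generator of the cutoff (chain rule)
  have hA : fderiv ℝ (P.hamiltonian N) x (P.bathVecL N T_L) = Real.sqrt (2 * P.γ * T_L) * x.2 ⟨0, hN⟩ :=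
    fderiv_hamiltonian_bathVec P hHd x hN _
  have hB : fderiv ℝ (P.hamiltonian N) x (P.bathVecR N T_R) = Real.sqrt (2 * P.γ * T_R) * x.2 ⟨N - 1, hN1⟩ :=
    fderiv_hamiltonian_bathVec P hHd x hN1 _
  have hA' : fderiv ℝ e x (P.bathVecL N T_L) = Real.sqrt (2 * P.γ * T_L) * partialP ⟨0, hN⟩ e x :=
    fderiv_apply_bathVec hed x hN _
  have hB' : fderiv ℝ e x (P.bathVecR N T_R) = Real.sqrt (2 * P.γ * T_R) * partialP ⟨N - 1, hN1⟩ e x :=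
    fderiv_apply_bathVec hed x hN1 _
  have hcut : sdeGenerator (P.drift N) (P.bathVecL N T_L) (P.bathVecR N T_R)
      (fun y => smoothCutoff (P.hamiltonian N y / R)) x =
      P.γ * (deriv smoothCutoff (P.hamiltonian N x / R) / R *
            (T_L + T_R - x.2 ⟨0, hN⟩ ^ 2 - x.2 ⟨N - 1, hN1⟩ ^ 2) +
          deriv (deriv smoothCutoff) (P.hamiltonian N x / R) / R ^ 2 *
            (T_L * x.2 ⟨0, hN⟩ ^ 2 + T_R * x.2 ⟨N - 1, hN1⟩ ^ 2)) := by
    rw [sdeGenerator_comp (P.drift N) _ _ (hasDerivAt_scaled_smoothCutoff R)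
      (hasDerivAt_deriv_scaled_smoothCutoff R) hH2 x, P.sdeGenerator_drift_eq_generator hN hL hR hH2,
      generator_hamiltonian_eq P, sum_bath_ite_eq hN, hA, hB, mul_pow, mul_pow,
      Real.sq_sqrt (by linarith), Real.sq_sqrt (by linarith)]
    ring
  -- the carré du champ
  have hcdc : carreDuChamp (P.bathVecL N T_L) (P.bathVecR N T_R) e
      (fun y => smoothCutoff (P.hamiltonian N y / R)) x =
      deriv smoothCutoff (P.hamiltonian N x / R) / R *
        (2 * P.γ * T_L * x.2 ⟨0, hN⟩ * partialP ⟨0, hN⟩ e x +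
          2 * P.γ * T_R * x.2 ⟨N - 1, hN1⟩ * partialP ⟨N - 1, hN1⟩ e x) := by
    rw [carreDuChamp_comm, carreDuChamp_comp_left _ _ (hasDerivAt_scaled_smoothCutoff R) hHd, carreDuChamp_def,
      hA, hB, hA', hB']
    have h2L : Real.sqrt (2 * P.γ * T_L) * Real.sqrt (2 * P.γ * T_L) = 2 * P.γ * T_L :=
      Real.mul_self_sqrt (by linarith)
    have h2R : Real.sqrt (2 * P.γ * T_R) * Real.sqrt (2 * P.γ * T_R) = 2 * P.γ * T_R :=
      Real.mul_self_sqrt (by linarith)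
    calc _ = deriv smoothCutoff (P.hamiltonian N x / R) / R *
          ((Real.sqrt (2 * P.γ * T_L) * Real.sqrt (2 * P.γ * T_L)) * x.2 ⟨0, hN⟩ * partialP ⟨0, hN⟩ e x +
            (Real.sqrt (2 * P.γ * T_R) * Real.sqrt (2 * P.γ * T_R)) * x.2 ⟨N - 1, hN1⟩ *
              partialP ⟨N - 1, hN1⟩ e x) := by ring
      _ = _ := by rw [h2L, h2R]
  rw [hcut, hcdc]
  ring

end GeneratorCutoff

/-! ### Closed form of the truncation lemma -/

section Closed

/-- **Dynkin's identity by truncation** (registered sub-goal of `stub_siteEnergyDynkin`; closed form of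
`pinnedChain_dynkin_of_truncation`): for the pinned chain (`ω₂, β, γ > 0`, `lam ≥ 0`, `N ≥ 1`, equal bath
temperatures `T > 0`), `0 < θ < 1/T`, observables `e, ℓ` and truncations `f_n ∈ C²_c` with `f_n → e`, `L f_n → ℓ`
pointwise and `|f_n|, |L f_n| ≤ K e^{θH}`: `P_r e(z) - e(z) = ∫₀ʳ P_s ℓ(z) ds` for all `r ≥ 0`, `z`.
[cite: CuneoEckmannHairerReyBellet2018, §3 eq. (3.4)] -/
theorem pinnedChain_dynkinByTruncation :
    ∀ (ω₂ lam β γ : ℝ), 0 < ω₂ → 0 ≤ lam → 0 < β → 0 < γ → ∀ (N : ℕ), 0 < N → ∀ (T : ℝ), 0 < T →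
      ∀ (θ K : ℝ), 0 < θ → θ < 1 / T → ∀ (e ℓ : PhaseSpace N → ℝ) (f : ℕ → PhaseSpace N → ℝ),
      (∀ n, ContDiff ℝ 2 (f n)) → (∀ n, HasCompactSupport (f n)) →
      (∀ y, Filter.Tendsto (fun n => f n y) Filter.atTop (nhds (e y))) →
      (∀ y, Filter.Tendsto (fun n => (pinnedChain ω₂ lam β γ).generator N T T (f n) y) Filter.atTop (nhds (ℓ y))) →
      (∀ n y, |f n y| ≤ K * Real.exp (θ * (pinnedChain ω₂ lam β γ).hamiltonian N y)) →
      (∀ n y, |(pinnedChain ω₂ lam β γ).generator N T T (f n) y| ≤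
        K * Real.exp (θ * (pinnedChain ω₂ lam β γ).hamiltonian N y)) →
      ∀ (r : NNReal) (z : PhaseSpace N),
        ∫ y, e y ∂((pinnedChain ω₂ lam β γ).transitionKernel N T T r z) - e z =
          ∫ s in (0 : ℝ)..(r : ℝ), ∫ y, ℓ y ∂((pinnedChain ω₂ lam β γ).transitionKernel N T T s.toNNReal z) := by
  intro ω₂ lam β γ hω hl hβ hγ N hN T hT θ K hθ hθ' e ℓ f hf hfs hfe hfℓ hfb hLb r z
  exact pinnedChain_dynkin_of_truncation hω hl hβ hγ hN hT hθ hθ' f hf hfs hfe hfℓ hfb hLb r z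

end Closed

end Summit.AtomisticToContinuum.FouriersLaw.Theorems.SubdiffusiveBondHeat

end
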